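import Mathlib

/-!
# `Balaban1983to89.B11Eq171Criticality` — [Balaban1985Variational] Sect. G, (170)–(171) p. 305 and (178) p. 306:
# «⟨δA′, J⟩ = 0 for δA′: Q(U_k)δA′ = 0, R(U_k)D*δA′ = 0 … can be written simply as the equation 𝔓*(U_k)J = 0» —
# the linear-algebra equivalence, PROVED in abstract form

statement-level skeleton of published theorems with citation tags; proofs where landed; nothing here is a claim about the Yang–Mills mass gap

CITATION HEADER (lean-in-tree rule 2026-08-18).  T. Bałaban, *The variational problem and background fields in
renormalization group method for lattice gauge theories*, Commun. Math. Phys. **102**, 277–309 (1985),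
doi:10.1007/bf01229381 [Balaban1985Variational] (cell paper B11; held `paper:balaban1985-cmp102-variational-background`,
journal page = PDF page + 276).  Render `…-p030-x2.png` (p. 306, (178)) READ AS AN IMAGE by this seat (lit-balaban
reader/typer r08, 2026-08-20); p. 305 (170)–(171) and pp. 293–294 (105)–(107) from the render-verified transcript
`run/shared/lean/pub/pub-balaban/b2b-balaban-b11/transcript.md`.

THE PRINT.  p. 305 [PDF 29]: *«If we take such a configuration as U₀ in the expansion (74), then Eqs. (82), (99) are
satisfied for A′ = 0, hence we have ⟨δA′, J⟩ = 0 for δA′: Q(U_k)δA′ = 0, R(U_k)D^{η*}_{U_k}δA′ = 0, (170) where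
J = η^{-2} Im D^{η*}_{U_k}∂U_k. The above condition can be written simply as the equation 𝔓*(U_k)J = 0 (171)»*;
pp. 293–294 (105)–(107): *«By the definition of 𝔓 we obtain all the variations δA′ satisfying (102), if we take δA′ = 𝔓δA
for all variations δA, without any restrictions»*, ⟨δA′, J⟩ = ⟨𝔓δA, J⟩ = ⟨δA, 𝔓*J⟩; p. 306 [PDF 30]: *«⟨δA′, J⟩ = 0
for δA′: Q(U_k)δA′ = 0, (178) or P₀*(U_k)J = 0.»*

WHAT IS PROVED (abstract real inner product space; Mathlib only).  `P : E →ₗ[ℝ] E` a projection ONTO the tangent space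
`T` (`P x ∈ T` for all x, `P δ = δ` for δ ∈ T — (102)/(107)) with an adjoint `Padj` (`⟪P x, y⟫ = ⟪x, Padj y⟫`, the
print's 𝔓*).  Then `(∀ δ ∈ T, ⟪δ, J⟫ = 0) ↔ Padj J = 0` (`criticality_iff_adj_eq_zero`) — (170) ⇔ (171), and with
`T = ker Q` alone, (178) ⇔ `P₀*J = 0`.  NOT modelled: the operators 𝔓, P₀ of [5]/(131) themselves.  Unit
`lit-balaban-r08` (row B11.Eq170 / r08.81 of `HOME/lit-balaban-r08/ROWS-B11.md`).
-/

namespace Literature.MathematicalPhysics.QuantumFieldTheory.Balaban1983to89.B11Eq171Criticality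

open scoped InnerProductSpace

variable {E : Type*} [NormedAddCommGroup E] [InnerProductSpace ℝ E]

/-- **(170) ⇔ (171)** (and (178) ⇔ «P₀*(U_k)J = 0»): for a projection `P` onto the tangent space `T` with adjoint
`Padj`, the first-order condition `⟪δ, J⟫ = 0 for all δ ∈ T` is equivalent to `Padj J = 0`.
[cite: Balaban1985Variational, (170)–(171) p.305] -/
theorem criticality_iff_adj_eq_zero (T : Submodule ℝ E) {P Padj : E →ₗ[ℝ] E} (hPT : ∀ x : E, P x ∈ T)
    (hPid : ∀ δ ∈ T, P δ = δ) (hadj : ∀ x y : E, ⟪P x, y⟫_ℝ = ⟪x, Padj y⟫_ℝ) (J : E) :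
    (∀ δ ∈ T, ⟪δ, J⟫_ℝ = 0) ↔ Padj J = 0 := by
  constructor
  · intro h
    have hall : ∀ x : E, ⟪x, Padj J⟫_ℝ = 0 := fun x => by
      rw [← hadj]; exact h _ (hPT x)
    exact inner_self_eq_zero.1 (hall (Padj J))
  · intro h δ hδ
    rw [← hPid δ hδ, hadj, h, inner_zero_right]

/-- The substitution of pp. 293–294 (105)–(107): `⟪P δA, J⟫ = ⟪δA, Padj J⟫`, so `Padj J = 0` makes the first-order term vanish
for ALL unrestricted variations δA. [cite: Balaban1985Variational, (105) p.293, (106)–(107) p.294 + (171) p.305] -/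
theorem inner_proj_eq_zero_of_adj {P Padj : E →ₗ[ℝ] E} (hadj : ∀ x y : E, ⟪P x, y⟫_ℝ = ⟪x, Padj y⟫_ℝ) {J : E}
    (hJ : Padj J = 0) (δA : E) : ⟪P δA, J⟫_ℝ = 0 := by
  rw [hadj, hJ, inner_zero_right]

end Literature.MathematicalPhysics.QuantumFieldTheory.Balaban1983to89.B11Eq171Criticality
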